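import Summits.Ventures.Crystal3D.Theorems.StickyWulffConstantCoaxialWallLawVicinalCoherentTwin
import Summits.Ventures.Crystal3D.Theorems.StickyWulffConstantCoaxialWallLawVicinalCoherentFault
import Summits.Ventures.Crystal3D.Theorems.StickyWulffConstantGenericWallFloorCoaxialIff
import HarnessLib

/-!
# The incoherent debt of lane F is DEEP: no level-⅓ pair is left (crux `CoaxialWallLaw`, stmt-Ventures-19481,
# line `WallLedgerF`)

HONEST FRAMING. Venture `Summits/Ventures/Crystal3D` (cell `crystal3d-full`), helper `--supports` the crux `CoaxialWallLaw`
of `route-Ventures-StickyWulffConstant` (REGISTERED line `WallLedgerF`, open stub `stub_coaxialTwoSlabAdhesion`).  Book-keeping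
by theorem on top of `…VicinalSplit`; rung credit; F-C1 not moved; NOT the crux; no census.

`…VicinalCoherentTwin` / `…VicinalCoherentFault` prove that a pair of the vicinal core with a level-⅓ offset is a coherent Σ3
twin (twin case) or a coherent basal fault (translation case); a co-axial pair is one or the other (`eq_or_twin_of_coaxial`).
Hence the third debt of the split, `CoaxialTwoSlabAdhesionIncoherent` (vicinal ∧ ¬coherent-twin ∧ ¬coherent-fault), only
ever meets offsets of DEEPER level (`3·A₁⁻¹(t₂ − t₁) ∉ Λ₀`, i.e. `3^{-j}`, `j ≥ 2`):

* `DeepPair` — the offset is triadic but NOT of level ⅓ (as a pair predicate: `3·A₁⁻¹(t₂−t₁) ∉ Λ₀`);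
* **`CoaxialTwoSlabAdhesionIncoherentDeep`** `:= On (Vicinal ∧ ¬CoherentTwin ∧ ¬CoherentFault ∧ Deep)`;
* **`coaxialTwoSlabAdhesionIncoherent_iff_deep`** — it IS the incoherent debt (the level-⅓ part is empty);
* **`coaxialTwoSlabAdhesion_of_deepSplit`** — {E1, `StarPairFar`, coherent-twin debt, coherent-fault debt, deep incoherent
  debt} ⇒ the registered stub IN FULL.
READING for the planner: (F-thin-comm)'s level-⅓ scope is EMPTY — two-partial `⅓·slot`, `⅓⟨200⟩` and displaced-twin classes
are FREE for arbitrary fillings at every wall orientation; the incoherent programme (THIN/THICK, (F-loc)) is about the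
basal-tower offsets of level `1/9, 1/27, …` only; the census (STEP-2/3) is about coherent twins and basal faults only.
WHAT THIS IS NOT: a proof of any debt; F-C1 not moved.
-/

noncomputable section

namespace Summit.Ventures.Crystal3D.Theorems

open Summit.Ventures.Crystal3D Finset
open Summit.Ventures.Crystal3D.Cruxes.CoaxialWallLaw.WallLedgerF (CoaxialTwoSlabAdhesion)
open Literature.MathematicalPhysics.StatisticalMechanics (fccStacking barlowStacking IsHaggSeq contactDeficiency)
open scoped InnerProductSpace

/-- **Deep pair**: the offset is NOT of level ⅓ (`3·A₁⁻¹(t₂ − t₁) ∉ Λ₀`). -/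
def DeepPair : CoaxialPairPred := fun A₁ t₁ _ t₂ =>
  A₁.symm ((3 : ℝ) • (t₂ - t₁)) ∉ fccStacking 1 (Real.sqrt (2 / 3))

/-- **Debt 3′ — the DEEP incoherent vicinal pairs** (basal-tower offsets of level `3^{-j}`, `j ≥ 2`; THIN/THICK, (F-loc)). -/
def CoaxialTwoSlabAdhesionIncoherentDeep : Prop :=
  CoaxialTwoSlabAdhesionOn fun A₁ t₁ A₂ t₂ =>
    ((VicinalPair A₁ t₁ A₂ t₂ ∧ ¬ CoherentTwinPair A₁ t₁ A₂ t₂) ∧ ¬ CoherentFaultPair A₁ t₁ A₂ t₂) ∧ DeepPair A₁ t₁ A₂ t₂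

/-- **In the vicinal core, incoherent ⇒ deep.**  A co-axial pair of the vicinal core that is neither a coherent twin nor a
coherent fault has an offset of deeper level. -/
theorem deepPair_of_incoherent
    (A₁ : EuclideanSpace ℝ (Fin 3) ≃ₗᵢ[ℝ] EuclideanSpace ℝ (Fin 3)) (t₁ : EuclideanSpace ℝ (Fin 3))
    (A₂ : EuclideanSpace ℝ (Fin 3) ≃ₗᵢ[ℝ] EuclideanSpace ℝ (Fin 3)) (t₂ : EuclideanSpace ℝ (Fin 3))
    (hco : ∃ (L : EuclideanSpace ℝ (Fin 3) ≃ₗᵢ[ℝ] EuclideanSpace ℝ (Fin 3))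
        (s₁ s₂ : EuclideanSpace ℝ (Fin 3)) (σ σ' : ℤ → ℤ), IsHaggSeq σ ∧ IsHaggSeq σ' ∧
        (fun p => A₁ p + t₁) '' fccStacking 1 (Real.sqrt (2 / 3)) ⊆
          (fun p => L p + s₁) '' barlowStacking 1 (Real.sqrt (2 / 3)) σ ∧
        (fun p => A₂ p + t₂) '' fccStacking 1 (Real.sqrt (2 / 3)) ⊆
          (fun p => L p + s₂) '' barlowStacking 1 (Real.sqrt (2 / 3)) σ')
    (hV : VicinalPair A₁ t₁ A₂ t₂) (hT : ¬ CoherentTwinPair A₁ t₁ A₂ t₂) (hF : ¬ CoherentFaultPair A₁ t₁ A₂ t₂) :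
    DeepPair A₁ t₁ A₂ t₂ := by
  intro h3
  have hco0 := coaxial_translate A₁ A₂ t₁ t₂ 0 0 hco
  have h1 : (fun p : EuclideanSpace ℝ (Fin 3) => A₁ p + 0) = (A₁ : EuclideanSpace ℝ (Fin 3) → EuclideanSpace ℝ (Fin 3)) :=
    funext fun p => add_zero _
  have h2 : (fun p : EuclideanSpace ℝ (Fin 3) => A₂ p + 0) = (A₂ : EuclideanSpace ℝ (Fin 3) → EuclideanSpace ℝ (Fin 3)) :=
    funext fun p => add_zero _
  rw [h1, h2] at hco0
  rcases eq_or_twin_of_coaxial A₁ A₂ hco0 with heq | ⟨ν, hν, hmenu, htwin⟩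
  · exact hF (coherentFaultPair_of_vicinal_level_third A₁ t₁ A₂ t₂ hV heq.symm h3)
  · exact hT (coherentTwinPair_of_vicinal_level_third A₁ t₁ A₂ t₂ hV hν hmenu htwin h3)

/-- **The incoherent debt is the deep incoherent debt.** -/
theorem coaxialTwoSlabAdhesionIncoherent_iff_deep :
    CoaxialTwoSlabAdhesionIncoherent ↔ CoaxialTwoSlabAdhesionIncoherentDeep := by
  constructor
  · exact fun h => coaxialTwoSlabAdhesionOn_mono (fun _ _ _ _ hT => hT.1) h
  · intro h A₁ t₁ A₂ t₂ hco hne hS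
    exact h A₁ t₁ A₂ t₂ hco hne ⟨hS, deepPair_of_incoherent A₁ t₁ A₂ t₂ hco hS.1.1 hS.1.2 hS.2⟩

/-- **Re-assembly with the deep incoherent debt**: the three debts give the vicinal core. -/
theorem coaxialTwoSlabAdhesionVicinal_of_deepSplit (h₁ : CoaxialTwoSlabAdhesionCoherentTwin)
    (h₂ : CoaxialTwoSlabAdhesionCoherentFault) (h₃ : CoaxialTwoSlabAdhesionIncoherentDeep) :
    CoaxialTwoSlabAdhesionVicinal :=
  coaxialTwoSlabAdhesionVicinal_of_split h₁ h₂ (coaxialTwoSlabAdhesionIncoherent_iff_deep.2 h₃)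

open scoped Classical in
/-- **The registered stub IN FULL from E1, `StarPairFar`, the two coherent debts and the DEEP incoherent debt.** -/
theorem coaxialTwoSlabAdhesion_of_deepSplit
    {s₀ : EuclideanSpace ℝ (Fin 3)} (hs₀ : s₀ ∈ fccSlots)
    (hcert : ExactOnly 0 (fccSlots.filter fun w => 0 < ⟪w, s₀⟫_ℝ)) (hSP : StarPairFar)
    (h₁ : CoaxialTwoSlabAdhesionCoherentTwin) (h₂ : CoaxialTwoSlabAdhesionCoherentFault)
    (h₃ : CoaxialTwoSlabAdhesionIncoherentDeep) : CoaxialTwoSlabAdhesion :=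
  coaxialTwoSlabAdhesion_of_vicinal hs₀ hcert hSP (coaxialTwoSlabAdhesionVicinal_of_deepSplit h₁ h₂ h₃)

end Summit.Ventures.Crystal3D.Theorems

end
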